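import Literature.Probability.RandomPlanarGeometry.WholePlaneCurveAssembly
import Literature.Probability.RandomPlanarGeometry.WholePlaneSLEIncrements
import HarnessLib

/-!
# Whole-plane SLE_κ(ρ), `κ ≤ 4`: the chain of the stationary angle law is a.s. generated by a curve

Topic `Probability/RandomPlanarGeometry`; theorems only (no definition, no named fact). The meeting
point of the deterministic assembly (`WholePlaneLoewnerChain.isCurve_tip_of_locallyGeneratedSimple`)
and the probabilistic input (`IsStationaryAngleLaw.ae_locallyGeneratedSimple_angleIncrPath`):
Miller–Sheffield (2013), Prop. 2.5 for whole-plane SLE_κ(ρ) in the regime `κ ≤ 4`,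
`κ ≤ 2(ρ + 2)`, granted a stationary angle law.

* `WholePlaneLoewnerChain.exists_rat_window` — **the horizons cover**: for a continuous driving
  angle, every time `t` lies in a window `(b, b + h_b)`, `b ∈ ℚ`, `h_b` the path horizon of the
  increment driver from `b` (the level-`n` angle flow started at `π` moves by at most
  `u cot δₙ + osc_λ(u)` in time `u`, uniformly for `b` in a compact set);
* `incr_drivingOfAngle` — the increment of the driving angle `λ = q + X` from `b` is the path
  functional `angleIncrPath X b`;
* `IsStationaryAngleLaw.ae_isCurve_tip` — **under a stationary SLE_κ(ρ) angle law with `κ ≤ 4`,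
  for `P`-a.e. angle path `X` and every phase `q₀`, the whole-plane Loewner chain driven by
  `λ = drivingOfAngle q₀ X` is generated by the continuous tip path `WholePlaneLoewner.tip λ`**, and
  the tip limits `F_s(R e^{iλ_s}) → tip λ s` hold at every time.

## References

* J. Miller, S. Sheffield, *Imaginary geometry IV*, PTRF 169 (2017), arXiv:1302.4738, Prop. 2.5.
  [MillerSheffield2013]
* G. F. Lawler, *Conformally Invariant Processes in the Plane*, AMS (2005), §6.5–6.6. [Lawler2005]
-/

noncomputable section

open MeasureTheory ProbabilityTheory Filter Topology Set Metric Complex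
open scoped NNReal ENNReal Real

namespace Literature.Probability.RandomPlanarGeometry

open scoped PathBorel
open RadialSLE RadialLoewner Literature.Probability.Process Literature.Analysis.FunctionSpaces

namespace WholePlaneLoewnerChain

variable {lam : ℝ → ℝ}

/-- The increment driver of a continuous driving angle is continuous. [folklore] -/
theorem continuous_incr (hlam : Continuous lam) (b : ℝ) : Continuous (incr lam b) :=
  (hlam.comp (continuous_const.add NNReal.continuous_coe)).sub continuous_const

/-- `V_b(0) = 0`. [folklore] -/
@[simp] theorem incr_zero (lam : ℝ → ℝ) (b : ℝ) : incr lam b 0 = 0 := by simp [incr]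

/-- The increment driver as a continuous path. [folklore] -/
def incrPath (hlam : Continuous lam) (b : ℝ) : CPath := ⟨incr lam b, continuous_incr hlam b⟩

/-- **Uniform lower bound of the path horizons over base times in a compact interval.** For a
continuous driving angle and `t ∈ ℝ` there is `h₀ ∈ (0, 1]` with `h₀ ≤` the path horizon of the
increment driver from every base time `b ∈ [t - 1, t]`: the level-`n` angle flow started at `π`
satisfies `|Y_u - π| ≤ u cot δₙ + |λ_{b+u} - λ_b|` (`argTrunc_eq_integral`, `abs_cotTrunc_le`), which
is `< π - 2ε` for `u ≤ h₀` by uniform continuity of `λ` on `[t - 1, t + 1]`. [folklore] -/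
theorem exists_pathHorizon_ge (hlam : Continuous lam) (n : ℕ) {ε : ℝ} (hε2 : ε < π / 2)
    {T : ℝ≥0} (hT : 0 < T) (t : ℝ) :
    ∃ h₀ : ℝ≥0, 0 < h₀ ∧ (h₀ : ℝ) ≤ 1 ∧ ∀ b ∈ Icc (t - 1) t, h₀ ≤ pathHorizon n ε T (incrPath hlam b) := by
  have hgap : 0 < π - 2 * ε := by linarith
  -- uniform continuity of `λ` on `[t - 1, t + 1]`
  obtain ⟨δ, hδ, hUC⟩ := Metric.uniformContinuousOn_iff.1
    (isCompact_Icc.uniformContinuousOn_of_continuous hlam.continuousOn : UniformContinuousOn lam (Icc (t - 1) (t + 1)))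
    ((π - 2 * ε) / 2) (by linarith)
  set c : ℝ := Real.cot (level n) with hc
  have hc0 : 0 ≤ c := (abs_nonneg _).trans (abs_cotTrunc_le (level_pos n) (level_le n) 0)
  set u₀ : ℝ := min (1 / 2) (min (δ / 2) ((π - 2 * ε) / (2 * (c + 1)))) with hu₀
  have hu₀pos : 0 < u₀ := lt_min (by norm_num) (lt_min (by linarith) (div_pos hgap (by linarith)))
  have hu₀le1 : u₀ ≤ 1 := (min_le_left _ _).trans (by norm_num)
  have hu₀δ : u₀ < δ := (min_le_right _ _).trans_lt ((min_le_left _ _).trans_lt (by linarith))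
  have hu₀c : u₀ * c < (π - 2 * ε) / 2 := by
    have h1 : u₀ ≤ (π - 2 * ε) / (2 * (c + 1)) := (min_le_right _ _).trans (min_le_right _ _)
    calc u₀ * c ≤ (π - 2 * ε) / (2 * (c + 1)) * c := mul_le_mul_of_nonneg_right h1 hc0
      _ < (π - 2 * ε) / 2 := by
          rw [div_mul_eq_mul_div, div_lt_div_iff₀ (by linarith) (by norm_num)]
          nlinarith
  set v₀ : ℝ≥0 := ⟨u₀, hu₀pos.le⟩ with hv₀
  have hv₀c : ((v₀ : ℝ≥0) : ℝ) = u₀ := rfl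
  set h₀ : ℝ≥0 := min T v₀ with hh₀
  have hh₀u : ((h₀ : ℝ≥0) : ℝ) ≤ u₀ := by
    rw [← hv₀c]; exact_mod_cast min_le_right T v₀
  have hv₀pos : 0 < v₀ := by rw [← NNReal.coe_pos, hv₀c]; exact hu₀pos
  refine ⟨h₀, lt_min hT hv₀pos, hh₀u.trans hu₀le1, fun b hb ↦ ?_⟩
  set p : CPath := incrPath hlam b with hp
  -- the flow stays in the band up to time `u₀`
  have hband : ∀ j : ℝ≥0, (j : ℝ) ≤ u₀ →
      argTrunc cpathDriving (level n) continuous_cpathDriving (level_pos n) (level_le n) π j p ∈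
        Ioo (2 * ε) (2 * π - 2 * ε) := by
    intro j hj
    set A : ℝ≥0 → ℝ := fun s ↦ argTrunc cpathDriving (level n) continuous_cpathDriving (level_pos n) (level_le n) π s p
    have hint := argTrunc_eq_integral continuous_cpathDriving (level_pos n) (level_le n) π p (t := j)
    have hI : ‖∫ s in (0 : ℝ)..j, cotTrunc (level n) (A s.toNNReal / 2)‖ ≤ c * |(j : ℝ) - 0| :=
      intervalIntegral.norm_integral_le_of_norm_le_const fun s _ ↦ by
        rw [Real.norm_eq_abs]; exact abs_cotTrunc_le (level_pos n) (level_le n) _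
    rw [sub_zero, abs_of_nonneg j.coe_nonneg] at hI
    have hp0 : cpathDriving p 0 = 0 := incr_zero lam b
    have hpj : |cpathDriving p j| < (π - 2 * ε) / 2 := by
      show |incr lam b j| < (π - 2 * ε) / 2
      simp only [incr]
      have h1 : b + j ∈ Icc (t - 1) (t + 1) := ⟨by linarith [hb.1, j.coe_nonneg], by linarith [hb.2, hj, hu₀le1]⟩
      have h2 : b ∈ Icc (t - 1) (t + 1) := ⟨hb.1, by linarith [hb.2]⟩
      have h3 : dist (b + j) b < δ := by
        rw [Real.dist_eq, add_sub_cancel_left, abs_of_nonneg j.coe_nonneg]; linarith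
      have := hUC (b + j) h1 b h2 h3
      rwa [Real.dist_eq] at this
    have hAj : |A j - π| < π - 2 * ε := by
      have heq : A j - π = (∫ s in (0 : ℝ)..j, cotTrunc (level n) (A s.toNNReal / 2)) - cpathDriving p j := by
        show argTrunc cpathDriving (level n) continuous_cpathDriving (level_pos n) (level_le n) π j p - π = _
        rw [hint, hp0, sub_zero]; ring
      rw [heq]
      calc |(∫ s in (0 : ℝ)..j, cotTrunc (level n) (A s.toNNReal / 2)) - cpathDriving p j|
          ≤ |∫ s in (0 : ℝ)..j, cotTrunc (level n) (A s.toNNReal / 2)| + |cpathDriving p j| := abs_sub _ _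
        _ < (π - 2 * ε) / 2 + (π - 2 * ε) / 2 := by
            refine add_lt_add_of_le_of_lt ?_ hpj
            rw [← Real.norm_eq_abs]
            exact hI.trans ((mul_comm _ _).le.trans ((mul_le_mul_of_nonneg_right hj hc0).trans hu₀c.le))
        _ = π - 2 * ε := by ring
    rw [abs_lt] at hAj
    exact ⟨by linarith [hAj.1], by linarith [hAj.2]⟩
  -- hence the stopped flow as well, and the exit time exceeds `u₀`
  have hflow : ∀ j : ℝ≥0, (j : ℝ) ≤ u₀ → pathFlow n π j p ∈ Ioo (2 * ε) (2 * π - 2 * ε) := by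
    intro j hj
    simp only [pathFlow, stoppedProcess, argLevel]
    exact hband _ ((NNReal.coe_le_coe.2 (untopA_min_le j _)).trans hj)
  have hexit : (v₀ : WithTop ℝ≥0) < SchrammWilson.bandExit ε (fun t (q : CPath) ↦ pathFlow n π t q) p := by
    rw [← not_le, SchrammWilson.bandExit, Process.exitTime_le_coe_iff (continuous_pathFlow n π p)]
    rintro ⟨j, hj, hjm⟩
    exact hjm (hflow j (by rw [← hv₀c]; exact_mod_cast hj))
  -- conclusion
  rw [← WithTop.coe_le_coe, coe_pathHorizon, hh₀, WithTop.coe_min]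
  exact min_le_min le_rfl hexit.le

/-- **The horizons cover**: every time lies in a window `(b, b + h_b)` with rational `b`, `h_b` the
path horizon of the increment driver from `b`. [folklore] -/
theorem exists_rat_window (hlam : Continuous lam) (n : ℕ) {ε : ℝ} (hε2 : ε < π / 2)
    {T : ℝ≥0} (hT : 0 < T) (t : ℝ) :
    ∃ b : ℚ, (b : ℝ) < t ∧ t < b + pathHorizon n ε T (incrPath hlam b) := by
  obtain ⟨h₀, hh₀, hh₀1, hhor⟩ := exists_pathHorizon_ge hlam n hε2 hT t
  have hh₀' : (0 : ℝ) < h₀ := by exact_mod_cast hh₀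
  obtain ⟨b, hb1, hb2⟩ := exists_rat_btwn (show t - h₀ < t by linarith)
  refine ⟨b, hb2, ?_⟩
  have hb : (b : ℝ) ∈ Icc (t - 1) t := ⟨by linarith, hb2.le⟩
  have := NNReal.coe_le_coe.2 (hhor b hb)
  linarith

end WholePlaneLoewnerChain

/-! ### The driving angle of an angle path -/

/-- **The increment of the driving angle from `b` is the path functional `angleIncrPath X b`.**
[cite: MillerSheffield2013, §2.1.2] -/
theorem incr_drivingOfAngle {x : C(ℝ, ℝ)} (hx : ∀ t, x t ∈ Ioo 0 (2 * π)) (q₀ b : ℝ) :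
    WholePlaneLoewnerChain.incr (drivingOfAngle q₀ x) b = angleIncrPath x b := by
  funext u
  simp only [WholePlaneLoewnerChain.incr, drivingOfAngle, angleIncrPath_apply]
  have hi : ∀ a c : ℝ, IntervalIntegrable (fun s ↦ Real.cot (x s / 2)) volume a c := fun a c ↦
    (continuous_cot_half hx).intervalIntegrable a c
  have := intervalIntegral.integral_add_adjacent_intervals (hi 0 b) (hi b (b + u))
  linarith

variable {κ : ℝ≥0} {ρ : ℝ} {P : Measure C(ℝ, ℝ)}

/-- **Whole-plane SLE_κ(ρ) is generated by a curve, `κ ≤ 4` (a.s. form on the angle path space).**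
Under a stationary SLE_κ(ρ) angle law with `0 < κ ≤ 4`, for `P`-a.e. angle path `X` and every phase
`q₀`, the driving angle `λ = drivingOfAngle q₀ X` is continuous, every whole-plane Loewner chain
driven by it is generated (`IsCurve`) by the tip path `WholePlaneLoewner.tip λ`, and the tip limits
hold at every time. Proof: a.s., from every rational base time the increment driver is locally
generated inside the disc up to its path horizon (`ae_locallyGeneratedSimple_angleIncrPath`,
countably many base times); the horizons cover (`exists_rat_window`); conclude by
`isCurve_tip_of_locallyGeneratedSimple`. [cite: MillerSheffield2013, Prop. 2.5] -/
theorem IsStationaryAngleLaw.ae_isCurve_tip (hP : IsStationaryAngleLaw κ ρ P) (hκ : 0 < κ) (hκ4 : κ ≤ 4) :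
    ∀ᵐ x ∂P, ∀ q₀ : ℝ, Continuous (drivingOfAngle q₀ x) ∧
      (∀ C : WholePlaneLoewnerChain (drivingOfAngle q₀ x), C.IsCurve (WholePlaneLoewner.tip (drivingOfAngle q₀ x))) ∧
      ∀ s : ℝ, Tendsto (fun R : ℝ ↦ WholePlaneLoewner.BackwardFlow.invMap (drivingOfAngle q₀ x) s
          ((R : ℂ) * Complex.exp ((drivingOfAngle q₀ x s : ℝ) * Complex.I)))
        (𝓝[>] 1) (𝓝 (WholePlaneLoewner.tip (drivingOfAngle q₀ x) s)) := by
  -- constants: `ε = 1`, `n = 4` (`2 δ₄ = 2/5 < 1/2`), `T = 1`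
  have hε : (0 : ℝ) < 1 := one_pos
  have hε2 : (1 : ℝ) < π / 2 := by linarith [Real.pi_gt_three]
  have hnε : 2 * level 4 < (1 : ℝ) / 2 := by rw [level]; norm_num
  have hT : (0 : ℝ≥0) < 1 := one_pos
  have hall : ∀ᵐ x ∂P, ∀ b : ℚ, ∃ hc : Continuous (angleIncrPath x b),
      LocallyGeneratedSimple (angleIncrPath x b) (pathHorizon 4 1 1 ⟨angleIncrPath x b, hc⟩) :=
    ae_all_iff.2 fun b ↦ hP.ae_locallyGeneratedSimple_angleIncrPath hκ hκ4 b hε hε2 hnε 1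
  filter_upwards [hall, hP.2.1] with x hx hxI q₀
  have hlam : Continuous (drivingOfAngle q₀ x) := continuous_drivingOfAngle q₀ x hxI
  have hloc : ∀ t : ℝ, ∃ b h : ℝ, b < t ∧ t < b + h ∧
      LocallyGeneratedSimple (WholePlaneLoewnerChain.incr (drivingOfAngle q₀ x) b) h := by
    intro t
    obtain ⟨b, hbt, htb⟩ := WholePlaneLoewnerChain.exists_rat_window hlam 4 hε2 hT t
    refine ⟨b, pathHorizon 4 1 1 (WholePlaneLoewnerChain.incrPath hlam b), hbt, htb, ?_⟩
    obtain ⟨hc, hLG⟩ := hx b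
    have he : WholePlaneLoewnerChain.incr (drivingOfAngle q₀ x) b = angleIncrPath x b := incr_drivingOfAngle hxI q₀ b
    have hpe : WholePlaneLoewnerChain.incrPath hlam b = ⟨angleIncrPath x b, hc⟩ := Subtype.ext he
    rw [hpe, he]
    exact hLG
  refine ⟨hlam, fun C ↦ (C.isCurve_tip_of_locallyGeneratedSimple hlam hloc).1, ?_⟩
  obtain ⟨⟨C⟩, -⟩ := WholePlaneLoewnerChain.exists_unique_holds _ hlam
  exact (C.isCurve_tip_of_locallyGeneratedSimple hlam hloc).2

end Literature.Probability.RandomPlanarGeometry
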